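import Summits.Parity.GeneralizedHardyLittlewood.Theorems.GreenTaoLevelTwoGITwoCyclicInverseLocalQuadraticData

/-!
# Route `GreenTaoLevelTwo`, crux `GITwo` (stmt-Parity-21275), line `birth`, stub `stub_cyclicInverse`:
# the local quadratic correlation with constants UNIFORM in `N`

Helper toward the XL stub `stub_cyclicInverse` (B. Green, T. Tao, *An inverse theorem for the Gowers
`U³(G)` norm*, arXiv:math/0503014, Thm. 68 = PEMS 51 (2008) Thm. 12.8).  Block E17, bookkeeping step:
the stub quantifies its constants BEFORE `N` and `f`, so the raw data of `local_quadratic_correlation_data`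
(dimension `d ≤ (2²²⁵/ε¹⁶⁸)¹⁷`, `#S`, `#F`, `#S'`, radii chain) are converted into three numbers depending on
`ε` only: an upper bound `D` for the number of frequencies `#S'`, a lower bound `K` for the correlation
parameter `κ = ε¹⁷2⁻²³128⁻ᵈ√(ε/2)`, and a lower bound `R` for the radius `ρ₅` of the regular Bohr set.

* `local_quadratic_correlation_uniform`.

References: [GreenTao2008U3Inverse] arXiv:math/0503014, Thm. 17 (i), §9, constants of Thm. 68.
-/

noncomputable section

namespace Summit.Parity.GeneralizedHardyLittlewood.GreenTaoLevelTwoGITwoCyclicInverse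

open Finset ZMod
open Literature.NumberTheory.Sieve

/-- **Local quadratic correlation with `N`-uniform constants.**  For `0 < ε ≤ 1` there are `D : ℕ` and
`K, R > 0` (`K ≤ 1`) such that for every prime `M > 2` and every `1`-bounded `f : ℤ/Mℤ → ℝ` with
`ε ≤ ‖f‖⁸_{U³}` there are `k ∈ [K,1]`, a frequency set `S' ∋ 1` with `#S' ≤ D`, `c` with `2c = 1`, a map
`μ` additive on the Bohr set `B(S',ρ₄)` (`ρ₄ ≤ 1/8`), a regular Bohr set `B(S',ρ₅)` with
`R ≤ ρ₅ ≤ ρ₄/(100 #S')`, `x₀ ∈ B(S',ρ₄)` and `t, ζ` with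
`(k/16) · #B(S',ρ₅) ≤ ‖∑_{w ∈ B(S',ρ₅)} f(w+t) e(c μ(x₀+w)(x₀+w)/M) e(wζ/M)‖`.
[cite: GreenTao2008U3Inverse, Thm. 17 (i), §9 and the constants of Thm. 68] -/
theorem local_quadratic_correlation_uniform {ε : ℝ} (hε0 : 0 < ε) (hε1 : ε ≤ 1) :
    ∃ (D : ℕ) (K R : ℝ), 0 < K ∧ K ≤ 1 ∧ 0 < R ∧
      ∀ (M : ℕ) [NeZero M], M.Prime → 2 < M → ∀ f : ZMod M → ℝ, (∀ x, |f x| ≤ 1) →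
        ε ≤ gowersPower 3 f →
        ∃ (k : ℝ) (S' : Finset (ZMod M)) (c : ZMod M) (μ : ZMod M → ZMod M) (ρ₄ ρ₅ : ℝ)
          (x₀ t ζ : ZMod M),
          K ≤ k ∧ k ≤ 1 ∧ #S' ≤ D ∧ (1 : ZMod M) ∈ S' ∧ 2 * c = 1 ∧ R ≤ ρ₅ ∧ 0 < ρ₅ ∧
          ρ₅ ≤ ρ₄ / (100 * (#S' : ℝ)) ∧ ρ₄ ≤ 1 / 8 ∧
          (∀ r : ℝ, |r| ≤ 1 / (100 * (#S' : ℝ)) →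
            (1 - 100 * (#S' : ℝ) * |r|) * #{x : ZMod M | ∀ ξ ∈ S', ‖ZMod.toAddCircle (x * ξ)‖ < ρ₅} ≤
                #{x : ZMod M | ∀ ξ ∈ S', ‖ZMod.toAddCircle (x * ξ)‖ < (1 + r) * ρ₅} ∧
              (#{x : ZMod M | ∀ ξ ∈ S', ‖ZMod.toAddCircle (x * ξ)‖ < (1 + r) * ρ₅} : ℝ) ≤
                (1 + 100 * (#S' : ℝ) * |r|) *
                  #{x : ZMod M | ∀ ξ ∈ S', ‖ZMod.toAddCircle (x * ξ)‖ < ρ₅}) ∧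
          (∀ x ∈ ({v : ZMod M | ∀ ξ ∈ S', ‖ZMod.toAddCircle (v * ξ)‖ < ρ₄} : Finset (ZMod M)),
            ∀ h ∈ ({v : ZMod M | ∀ ξ ∈ S', ‖ZMod.toAddCircle (v * ξ)‖ < ρ₄} : Finset (ZMod M)),
              μ (x + h) = μ x + μ h) ∧
          x₀ ∈ ({v : ZMod M | ∀ ξ ∈ S', ‖ZMod.toAddCircle (v * ξ)‖ < ρ₄} : Finset (ZMod M)) ∧
          k / 16 * #{x : ZMod M | ∀ ξ ∈ S', ‖ZMod.toAddCircle (x * ξ)‖ < ρ₅} ≤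
            ‖∑ w ∈ ({x : ZMod M | ∀ ξ ∈ S', ‖ZMod.toAddCircle (x * ξ)‖ < ρ₅} : Finset (ZMod M)),
              ((f (w + t) : ℝ) : ℂ) * stdAddChar (c * μ (x₀ + w) * (x₀ + w)) * stdAddChar (w * ζ)‖ := by
  classical
  -- the constants
  obtain ⟨Dn, hDn⟩ : ∃ Dn : ℕ, Dn = ⌊((2 : ℝ) ^ 225 / ε ^ 168) ^ 17⌋₊ := ⟨_, rfl⟩
  obtain ⟨β, hβ⟩ : ∃ β : ℝ, β = ε ^ 17 / 2 ^ 23 / (128 : ℝ) ^ Dn := ⟨_, rfl⟩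
  have hβ0 : 0 < β := by rw [hβ]; positivity
  obtain ⟨K, hK⟩ : ∃ K : ℝ, K = β * Real.sqrt (ε / 2) := ⟨_, rfl⟩
  have hsq0 : 0 < Real.sqrt (ε / 2) := Real.sqrt_pos.mpr (by linarith)
  have hK0 : 0 < K := by rw [hK]; positivity
  obtain ⟨S₀, hS₀⟩ : ∃ S₀ : ℝ, S₀ = 1 + 4 / β ^ 2 := ⟨_, rfl⟩
  have hS₀1 : 1 ≤ S₀ := by rw [hS₀]; exact le_add_of_nonneg_right (by positivity)
  have hS₀0 : 0 < S₀ := by linarith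
  obtain ⟨F₀, hF₀⟩ : ∃ F₀ : ℝ, F₀ = 128 / ((K ^ 4) / 8) ^ 4 := ⟨_, rfl⟩
  have hF₀0 : 0 ≤ F₀ := by rw [hF₀]; positivity
  obtain ⟨D, hD⟩ : ∃ D : ℕ, D = ⌊S₀ + F₀ + S₀ + 1⌋₊ := ⟨_, rfl⟩
  have hD1 : 1 ≤ D := by
    rw [hD]; exact Nat.le_floor (by push_cast; linarith)
  have hDpos : (0 : ℝ) < D := by exact_mod_cast hD1
  obtain ⟨R₂, hR₂⟩ : ∃ R₂ : ℝ, R₂ = K ^ 2 * (1 / 16) / (1600 * S₀) := ⟨_, rfl⟩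
  have hR₂0 : 0 < R₂ := by rw [hR₂]; positivity
  obtain ⟨R', hR'⟩ : ∃ R' : ℝ, R' = (K ^ 4 / 8) / (800 * S₀) * R₂ := ⟨_, rfl⟩
  have hR'0 : 0 < R' := by rw [hR']; positivity
  obtain ⟨R₄, hR₄⟩ : ∃ R₄ : ℝ, R₄ = min (1 / 12) (min ((K ^ 4 / 8) ^ 8 / (2 ^ 32 * S₀) * R')
      (min (min (1 / (100 * S₀)) (K / (400 * S₀)) * (1 / 16))
        (K * R₂ * (K ^ 4 / 8) ^ 2 / (2 ^ 19 * Real.pi * S₀)))) / 2 := ⟨_, rfl⟩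
  have hR₄0 : 0 < R₄ := by
    rw [hR₄]
    refine div_pos (lt_min (by norm_num) (lt_min (by positivity) (lt_min ?_ (by positivity))))
      two_pos
    exact mul_pos (lt_min (by positivity) (by positivity)) (by norm_num)
  obtain ⟨R, hR⟩ : ∃ R : ℝ, R = min (1 / (100 * (D : ℝ))) (K / (1600 * (D : ℝ))) * R₄ / 2 :=
    ⟨_, rfl⟩
  have hR0 : 0 < R := by
    rw [hR]; exact div_pos (mul_pos (lt_min (by positivity) (by positivity)) hR₄0) two_pos
  -- `K ≤ 1`
  have hK1 : K ≤ 1 := by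
    rw [hK, hβ]
    have h1 : ε ^ 17 ≤ 1 := pow_le_one₀ hε0.le hε1
    have h2 : Real.sqrt (ε / 2) ≤ 1 := by rw [Real.sqrt_le_one]; linarith
    have h3 : (1 : ℝ) ≤ (128 : ℝ) ^ Dn := one_le_pow₀ (by norm_num)
    have h4 : ε ^ 17 / 2 ^ 23 / (128 : ℝ) ^ Dn ≤ 1 := by
      rw [div_le_one (by positivity)]
      calc ε ^ 17 / 2 ^ 23 ≤ 1 / 2 ^ 23 := by gcongr
        _ ≤ 1 := by norm_num
        _ ≤ (128 : ℝ) ^ Dn := h3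
    calc ε ^ 17 / 2 ^ 23 / (128 : ℝ) ^ Dn * Real.sqrt (ε / 2) ≤ 1 * 1 :=
          mul_le_mul h4 h2 (Real.sqrt_nonneg _) zero_le_one
      _ = 1 := one_mul 1
  refine ⟨D, K, R, hK0, hK1, hR0, ?_⟩
  intro M _ hM h2 f hf hε
  obtain ⟨d, S, F, S', c, μ, ρ, ρ₂, ρ', ρ₄, ρ₅, x₀, t, ζ, ⟨hS'def, hS, hScard, hFcard, hρ1, hρ2,
    hρ₂, hρ', hρ₄, hρ₅⟩, hd, hS'ne, h1S', hc, hρ₅0, hρ₅hi, hρ₄8, hreg₅, haddA, hx₀, hbig⟩ :=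
    local_quadratic_correlation_data hM h2 hf hε0 hε1 hε
  -- the correlation parameter of this datum
  obtain ⟨k, hk⟩ : ∃ k : ℝ, k = ε ^ 17 / 2 ^ 23 / (128 : ℝ) ^ d * Real.sqrt (ε / 2) := ⟨_, rfl⟩
  have hk0 : 0 < k := by rw [hk]; positivity
  -- `d ≤ Dn`, hence `K ≤ k`
  have hdDn : d ≤ Dn := by rw [hDn]; exact Nat.le_floor hd
  have hpow : (128 : ℝ) ^ d ≤ (128 : ℝ) ^ Dn := pow_le_pow_right₀ (by norm_num) hdDn
  have hβd : β ≤ ε ^ 17 / 2 ^ 23 / (128 : ℝ) ^ d := by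
    rw [hβ]; exact div_le_div_of_nonneg_left (by positivity) (by positivity) hpow
  have hKk : K ≤ k := by
    rw [hK, hk]; exact mul_le_mul_of_nonneg_right hβd (Real.sqrt_nonneg _)
  have hk1 : k ≤ 1 := by
    rw [hk]
    have h1 : ε ^ 17 ≤ 1 := pow_le_one₀ hε0.le hε1
    have h2' : Real.sqrt (ε / 2) ≤ 1 := by rw [Real.sqrt_le_one]; linarith
    have h3 : (1 : ℝ) ≤ (128 : ℝ) ^ d := one_le_pow₀ (by norm_num)
    have h4 : ε ^ 17 / 2 ^ 23 / (128 : ℝ) ^ d ≤ 1 := by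
      rw [div_le_one (by positivity)]
      calc ε ^ 17 / 2 ^ 23 ≤ 1 / 2 ^ 23 := by gcongr
        _ ≤ 1 := by norm_num
        _ ≤ (128 : ℝ) ^ d := h3
    calc ε ^ 17 / 2 ^ 23 / (128 : ℝ) ^ d * Real.sqrt (ε / 2) ≤ 1 * 1 :=
          mul_le_mul h4 h2' (Real.sqrt_nonneg _) zero_le_one
      _ = 1 := one_mul 1
  -- sizes
  have hSpos : (0 : ℝ) < #S := by exact_mod_cast card_pos.mpr hS
  have hS'pos : (0 : ℝ) < #S' := by exact_mod_cast card_pos.mpr hS'ne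
  have hSS₀ : (#S : ℝ) ≤ S₀ := by
    rw [hS₀]
    refine hScard.trans ?_
    have : 4 / (ε ^ 17 / 2 ^ 23 / (128 : ℝ) ^ d) ^ 2 ≤ 4 / β ^ 2 := by
      apply div_le_div_of_nonneg_left (by norm_num) (by positivity)
      exact pow_le_pow_left₀ hβ0.le hβd 2
    linarith
  have hFF₀ : (#F : ℝ) ≤ F₀ := by
    rw [hF₀]
    rw [← hk] at hFcard
    refine hFcard.trans ?_
    apply div_le_div_of_nonneg_left (by norm_num) (by positivity)
    gcongr
  have hS'D : #S' ≤ D := by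
    rw [hD]
    refine Nat.le_floor ?_
    have himg : (#(S.image (fun ξ => c * ξ)) : ℝ) ≤ #S := by exact_mod_cast card_image_le
    have h1 : #S' ≤ #S + #F + #(S.image (fun ξ => c * ξ)) + 1 := by
      rw [hS'def]
      calc #(S ∪ F ∪ S.image (fun ξ => c * ξ) ∪ {1})
          ≤ #(S ∪ F ∪ S.image (fun ξ => c * ξ)) + #({1} : Finset (ZMod M)) := card_union_le _ _
        _ ≤ #(S ∪ F) + #(S.image (fun ξ => c * ξ)) + 1 := by
            rw [card_singleton]; exact Nat.add_le_add_right (card_union_le _ _) _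
        _ ≤ #S + #F + #(S.image (fun ξ => c * ξ)) + 1 := by
            gcongr; exact card_union_le _ _
    have h2 : (#S' : ℝ) ≤ #S + #F + #(S.image (fun ξ => c * ξ)) + 1 := by exact_mod_cast h1
    linarith
  have hS'Dr : (#S' : ℝ) ≤ D := by exact_mod_cast hS'D
  -- radii
  rw [← hk] at hρ₂ hρ' hρ₄ hρ₅ hbig
  have hR₂ρ₂ : R₂ ≤ ρ₂ := by
    rw [hR₂]
    refine le_trans ?_ hρ₂
    gcongr
  have hR'ρ' : R' ≤ ρ' := by
    rw [hR']
    refine le_trans ?_ hρ'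
    gcongr
  have hρ₂0 : 0 < ρ₂ := hR₂0.trans_le hR₂ρ₂
  have hρ'0 : 0 < ρ' := hR'0.trans_le hR'ρ'
  have hR₄ρ₄ : R₄ ≤ ρ₄ := by
    rw [hR₄]
    refine le_trans ?_ hρ₄
    gcongr
  have hRρ₅ : R ≤ ρ₅ := by
    rw [hR]
    refine le_trans ?_ hρ₅
    have hρ₄0 : 0 ≤ ρ₄ := hR₄0.le.trans hR₄ρ₄
    gcongr
  exact ⟨k, S', c, μ, ρ₄, ρ₅, x₀, t, ζ, hKk, hk1, hS'D, h1S', hc, hRρ₅, hρ₅0, hρ₅hi, hρ₄8, hreg₅,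
    haddA, hx₀, hbig⟩

end Summit.Parity.GeneralizedHardyLittlewood.GreenTaoLevelTwoGITwoCyclicInverse
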